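import Summits.BirchSwinnertonDyer.Rank1Residual.X11b.Three.CyclotomicNonsplit
import HarnessLib

/-!
# X11b at `p = 3` (and every odd `p`), NON-SPLIT multiplicative, WITHOUT (ram): the Euler-system
# HALF of the cyclotomic route modulo Schneider (team `x11b3` = N8/O2, sub-target T9-CYC-NS, part 2)

HONEST FRAMING (cell `b2b-bsdres`, run/shared/lean/b2b/bsd-rank1-residual/, verbatim): the goal of
the cell is to DELETE the COMBINATION-SHAPED residual classes for ALL analytic-rank `≤ 1` elliptic
curves over `ℚ` — "full BSD formula for every rank `≤ 1` curve in class C" assembled STRICTLY from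
published theorems — so that the rank-`≤ 1` remainder becomes exactly the CONSTRUCTION-SHAPED classes,
which are TYPED (missing-input `Prop`s), NOT attempted. This is not "finishing BSD". Team `x11b3`:
X11b at `p = 3`; research route; no claim beyond the stated sub-population; nothing booked; X11 ∧
`r = 1` ∧ `p = 3` stays CONSTRUCTION-SHAPED (REFEREE R6.2), O2 OPEN. THEOREMS ONLY (no definition, no
named fact, no `sorry`). Companion of `Three/CyclotomicNonsplit.lean` (the (ram) case: Skinner's
Thm. A gives EQUALITY of ideals, hence `BSD(E,p)` modulo Schneider).

## What this file proves

With only a DIVISIBILITY `g ∈ char_Λ X(E/ℚ_∞)`, `ι g = ϖ·L_p(E,T)` (Kato's theorem for surjective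
`ρ_{E,p^∞}` — Wuthrich 2014 Thm. 3 / Cor. 19 = Stein–Wuthrich 2013 Thm. 7.3, tree fact
`kato_charIdeal_dvd_multiplicative_of_surjective`, printed for `p ≠ 2` — instead of Skinner's Thm. A,
so NO (ram) prime is needed), the same engine gives the Euler-system HALF:

* `exists_cofactor_of_nonsplit_of_schneider_datum` — the X1 engine
  (`Wuthrich2014.exists_cofactor_of_mem_charIdeal_of_rank_one_odd`) transplanted to a NON-SPLIT
  multiplicative prime: Stein–Wuthrich Thm. 6.1 (`thm61_nonsplitMultiplicative`) in place of
  Perrin-Riou–Schneider, Disegni 2020 Thm. 1 (`Disegni2020.thm1_padicBSD_nonsplitMultiplicative`) in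
  place of Perrin-Riou 1987: for ANY `g ∈ char_Λ X` with `ι g = ϖ·L` and Schneider at the datum,
  `g = h·f_E`, `h(0) ≠ 0`, `#Ш(E)_an = s ∈ ℚ^×` and `ord_p s = ord_p h(0) + ord_p #Ш(E)[p^∞]`.
* `missingUpperBoundAt_of_nonsplit_of_mem_charIdeal_of_schneider_datum` — hence the typed UPPER bound
  `ord_p #Ш(E) ≤ ord_p #Ш(E)_an` (`Typed.MissingUpperBoundAt W p`; `ord_p h(0) ≥ 0`).
* `missingUpperBoundAt_of_classX11b_of_nonsplit_of_surjPow_of_schneider` — CLASS LEVEL on X11b ∧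
  nonsplit(`p`) ∧ `ρ_{E,p^∞}` surjective (`∀ n`, Kato's hypothesis), the bookkeeping data instantiated
  from tree theorems / published existence facts; `missingUpperBoundAt_three_of_isX11Three_of_nonsplit_of_surj_of_schneider`
  — the `p = 3` row with the census bit `Surj W 3` (3-adic surjectivity at a multiplicative `3` by
  Wuthrich's Lemma 20, `Typed.surjective_pow_three_of_mult`): the (T2′)@3-type input of
  `P2.bsdp_three_of_onTree` DISCHARGED on X11b@3 ∧ nonsplit ∧ surj(3) MODULO SCHNEIDER, with NO (ram)
  and NO `3 ∤ ∏ c_ℓ`.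
* `bsdp_three_of_isX11Three_of_nonsplit_of_surj_of_schneider_of_pow_dvd` — per-pair closer: the upper
  half + a LOWER divisibility certificate `3^j ∣ #Ш(E/ℚ)` with `ord_3 #Ш_an ≤ j` (an exact `3`-descent
  count via `pow_dvd_shaOrder_of_card_selmerGroup`, or Cassels–Tate) ⇒ `BSD(E,3)`. Target of record:
  the X11b@3 cell 318828a1 (`N = 2²·3·163²`: non-split at `3`, NO second multiplicative prime,
  `#Ш_an = 9`, exact `#Sel₃ = 27` in hand — one of the seven "no upper half" classes of
  CLASS-CLOSURE-PLAN §3.10).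

All CONDITIONAL on Schneider's non-degeneracy AT THE PAIR (open for non-CM curves; per pair a
numerical certificate — PARI `ellpadicregulator`; EVIDENCE in `HOME/b2b-bsdres-x11b3-p2/census/`,
kit job j120777: non-zero at all 723 non-split TRUE-OPEN X11b@3 cells); nothing booked; labels
UNCHANGED.

References: [Wuthrich2014] Thm. 3 (p. 382), Cor. 19 (p. 398), Lemma 20 (p. 400), §6;
[SteinWuthrich2013] Thm. 6.1 (p. 20), Thm. 7.3, §4.2; [Disegni2020] Thm. 1, Thm. 3, Thm. 4;
[Miller2011LMS] Def. 1.1; cell files `Wuthrich2014/RankOneEngineOddPrimeProofs.lean`,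
`Typed/PAdicCertificateMultiplicativeExists.lean`, `X11b/SelmerRankOne.lean`.
-/

set_option autoImplicit false

noncomputable section

open scoped Classical MatrixGroups ModularForm

open CongruenceSubgroup WeierstrassCurve Literature.NumberTheory.EllipticCurves
  Literature.NumberTheory.EllipticCurves.ModularForms
  Literature.NumberTheory.EllipticCurves.Rank1Residual
  Literature.NumberTheory.EllipticCurves.Rank1Residual.X11RankOneCertificates
  Literature.NumberTheory.EllipticCurves.Skinner2016
  Literature.NumberTheory.EllipticCurves.SteinWuthrich2013
  Literature.NumberTheory.EllipticCurves.Disegni2020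
  Literature.NumberTheory.EllipticCurves.Wuthrich2014

namespace Summit.BirchSwinnertonDyer.Rank1Residual.X11b.Three

/-! ### The cofactor engine (any divisibility) -/

/-- **The cofactor engine at a NON-SPLIT multiplicative prime** (the X1 engine
`Wuthrich2014.exists_cofactor_of_mem_charIdeal_of_rank_one_odd` transplanted: Stein–Wuthrich Thm. 6.1
in place of Perrin-Riou–Schneider, Disegni 2020 Thm. 1 in place of Perrin-Riou 1987). `W` globally
minimal, `p ≠ 2` non-split multiplicative, `ord_{s=1} L(E,s) ≤ 1`, cyclotomic `(κ, γ)`, `f` a newform,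
`ϖ·Ω_E = Ω⁺_f`, `L` THE non-split MTT function, `q` the Tate parameter, `Dh` THE §4.2 height with
`Reg_p ≠ 0` (`hSch`), `D` a dual datum with `X` torsion, and ANY `g ∈ char_Λ X` with `ι g = ϖ·L`
(Kato's divisibility for surjective `ρ_{E,p^∞}`, or Skinner's Thm. A). Then for a generator `f_E` of
`char_Λ X` and the cofactor `h` (`g = h·f_E`): `h(0) ≠ 0`, `#Ш(E)_an = s ∈ ℚ^×` and
`ord_p s = ord_p h(0) + ord_p #Ш(E)[p^∞]`. Inputs: SW Thm. 6.1 (`hJ`), Disegni Thm. 1 (`hD`), GZK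
(`hGZK`). [cite: SteinWuthrich2013, Thm. 6.1 (p. 20), §4.2 (p. 15)]
[cite: Disegni2020, Thm. 1, Thm. 4 and §3.2.1] [cite: Wuthrich2014, §6 (p. 400)] -/
theorem exists_cofactor_of_nonsplit_of_schneider_datum (hJ : thm61_nonsplitMultiplicative)
    (hD : thm1_padicBSD_nonsplitMultiplicative) (hGZK : rank_eq_analyticRank_of_analyticRank_le_one)
    (W : WeierstrassCurve ℚ) [W.IsElliptic] [W.IsGloballyMinimal] (p : ℕ) [Fact p.Prime]
    {κ : ZpExtension ℚ p} {γ : Field.absoluteGaloisGroup ℚ} {N : ℕ} [NeZero N]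
    {f : CuspForm (Gamma0 N) 2} (hp2 : p ≠ 2) (hr : W.analyticRank ≤ 1)
    (hmult : W.HasMultiplicativeReductionAtPrime p)
    (hns : ¬ W.HasSplitMultiplicativeReductionAtPrime p)
    (hκ : κ.IsCyclotomic) (hγ : κ.IsTopGenerator γ) (hγ' : IsCyclotomicVariable p γ)
    (hf : IsNewformOf W f) (D : W.SelmerDualData κ γ) (hX : D.IsTorsion) (ϖ : ℚ)
    (hϖ : (ϖ : ℝ) * W.realPeriodRat = plusPeriod f)
    (L : PowerSeries ℚ_[p]) (hL : IsMultPAdicLFunctionOf f p (-1) L)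
    {q : ℚ_[p]} (hq0 : q ≠ 0) (hq1 : ‖q‖ < 1) (hqj : tateJ q = (W.j : ℚ_[p]))
    (Dh : PAdicHeightData W p) (hDh : IsMultCanonical Dh q) (hSch : SchneiderConjecture Dh)
    (g : IwasawaAlgebra p) (hgmem : g ∈ D.charIdeal)
    (hιg : iwasawaToPowerSeries p g = PowerSeries.C ((ϖ : ℚ) : ℚ_[p]) * L) :
    ∃ (fE h : IwasawaAlgebra p) (s : ℚ), D.charIdeal = Ideal.span {fE} ∧ g = h * fE ∧
      PowerSeries.constantCoeff h ≠ 0 ∧ shaAn W = (s : ℂ) ∧ s ≠ 0 ∧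
      padicValRat p s = (((PowerSeries.constantCoeff h : ℤ_[p]) : ℚ_[p])).valuation +
        (padicValNat p (Nat.card (AddCommGroup.primaryComponent W.sha p)) : ℤ) := by
  -- Gross–Zagier–Kolyvagin: `rank E(ℚ) = r_an`, `Ш(E/ℚ)` finite
  obtain ⟨hrk, hfin⟩ := hGZK W hr
  haveI : Finite W.sha := hfin
  have hfinp : Finite (AddCommGroup.primaryComponent W.sha p) := inferInstance
  set r := W.mordellWeilRank with hr_def
  -- a generator `fE` of `char_Λ X` and the cofactor `h`
  haveI : Module.Finite (IwasawaAlgebra p) D.X := D.module_finite_holds hγ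
  haveI : (Module.charIdeal (IwasawaAlgebra p) D.X).IsPrincipal := charIdeal_isPrincipal_holds p D.X
  obtain ⟨fE, hchar⟩ := Submodule.IsPrincipal.principal (Module.charIdeal (IwasawaAlgebra p) D.X)
  have hchar' : D.charIdeal = Ideal.span {fE} := hchar
  have hgmem' : g ∈ Ideal.span {fE} := by rw [← hchar']; exact hgmem
  obtain ⟨h, hgh⟩ := Ideal.mem_span_singleton'.mp hgmem'
  -- Stein–Wuthrich Thm. 6.1 (non-split) at `fE`
  obtain ⟨hS1, -, hS3⟩ := hJ W p hp2 hmult hns q hq0 hq1 hqj κ γ hκ hγ hγ' D hX fE hchar' Dh hDh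
  obtain ⟨qq, hqq⟩ : (PowerSeries.X : IwasawaAlgebra p) ^ r ∣ fE :=
    PowerSeries.X_pow_dvd_iff.mpr fun m hm =>
      PowerSeries.coeff_of_lt_order m (lt_of_lt_of_le (by exact_mod_cast hm) hS1)
  obtain ⟨u, hu⟩ := hS3 hSch hfinp
  -- Disegni 2020 Thm. 1 at the same data
  obtain ⟨s, u', hs, hs0, hdis⟩ := (hD W p hp2 hmult hns hr q hq0 hq1 hqj Dh hDh f hf L hL ϖ hϖ).2.2
  rw [← hrk] at hdis
  -- coefficients at `T^r`
  have hcoeff_g : (PowerSeries.coeff r g : ℤ_[p]) =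
      PowerSeries.constantCoeff h * PowerSeries.constantCoeff qq := by
    rw [← hgh, hqq, show h * (PowerSeries.X ^ r * qq) = PowerSeries.X ^ r * (h * qq) by ring,
      PowerSeries.coeff_X_pow_mul', if_pos le_rfl, Nat.sub_self,
      PowerSeries.coeff_zero_eq_constantCoeff, map_mul]
  have hcoeff_fE : (PowerSeries.coeff r fE : ℤ_[p]) = PowerSeries.constantCoeff qq := by
    rw [hqq, PowerSeries.coeff_X_pow_mul', if_pos le_rfl, Nat.sub_self,
      PowerSeries.coeff_zero_eq_constantCoeff]
  have hcoeff_ιg : ((PowerSeries.coeff r g : ℤ_[p]) : ℚ_[p]) = (ϖ : ℚ_[p]) * PowerSeries.coeff r L := by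
    rw [← coeff_iwasawaToPowerSeries p g r, hιg, PowerSeries.coeff_C_mul]
  -- abbreviations in `ℚ_p`
  set h0 : ℚ_[p] := ((PowerSeries.constantCoeff h : ℤ_[p]) : ℚ_[p]) with hh0_def
  set lg : ℚ_[p] := padicLog p (cyclotomicGenerator p) ^ r with hlg_def
  set T2 : ℚ_[p] := (W.torsionOrder : ℚ_[p]) ^ 2 with hT2_def
  set Shp : ℚ_[p] := (Nat.card (AddCommGroup.primaryComponent W.sha p) : ℚ_[p]) with hShp_def
  set Rg : ℚ_[p] := padicRegulator Dh with hRg_def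
  set Cc : ℚ_[p] := (W.tamagawaProduct : ℚ_[p]) with hCc_def
  have hRg0 : Rg ≠ 0 := hSch
  have hCc0 : Cc ≠ 0 := by
    rw [hCc_def]; exact_mod_cast (W.tamagawaProduct_pos_holds : 0 < W.tamagawaProduct).ne'
  have h20 : (2 : ℚ_[p]) ≠ 0 := two_ne_zero
  -- `ϖ [T^r]L · lg · T2 = h0 · ([T^r]fE · lg · T2) = h0 · u · 2 Shp Rg Cc`, and `= u' · 2 s Rg Cc`
  have key : h0 * ((u : ℤ_[p]) : ℚ_[p]) * Shp * (2 * Rg * Cc) =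
      ((u' : ℤ_[p]) : ℚ_[p]) * (s : ℚ_[p]) * (2 * Rg * Cc) := by
    have e1 : (ϖ : ℚ_[p]) * PowerSeries.coeff r L =
        h0 * ((PowerSeries.coeff r fE : ℤ_[p]) : ℚ_[p]) := by
      rw [← hcoeff_ιg, hcoeff_g, hcoeff_fE, hh0_def]; push_cast; ring
    have e2 : (ϖ : ℚ_[p]) * PowerSeries.coeff r L * lg * T2 =
        h0 * (((u : ℤ_[p]) : ℚ_[p]) * (2 * (Shp * Rg * Cc))) := by
      rw [e1, mul_assoc h0, mul_assoc h0, hu]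
    linear_combination e2.symm.trans hdis
  have key2 : h0 * ((u : ℤ_[p]) : ℚ_[p]) * Shp = ((u' : ℤ_[p]) : ℚ_[p]) * (s : ℚ_[p]) :=
    mul_right_cancel₀ (mul_ne_zero (mul_ne_zero h20 hRg0) hCc0) key
  -- `h(0) ≠ 0` since `s ≠ 0`
  have hsQ0 : ((s : ℚ) : ℚ_[p]) ≠ 0 := by exact_mod_cast hs0
  have hh0ne : h0 ≠ 0 := by
    intro e
    apply mul_ne_zero (coe_units_ne_zero p u') hsQ0
    rw [← key2, e, zero_mul, zero_mul]
  have hh0 : PowerSeries.constantCoeff h ≠ 0 := by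
    intro e; apply hh0ne; rw [hh0_def, e]; rfl
  -- valuations
  have hShp0 : Shp ≠ 0 := by rw [hShp_def]; exact_mod_cast Nat.card_pos.ne'
  have hval : padicValRat p s = h0.valuation +
      (padicValNat p (Nat.card (AddCommGroup.primaryComponent W.sha p)) : ℤ) := by
    have hv := congrArg Padic.valuation key2
    rw [Padic.valuation_mul (mul_ne_zero hh0ne (coe_units_ne_zero p u)) hShp0,
      Padic.valuation_mul hh0ne (coe_units_ne_zero p u), valuation_coe_units_eq_zero, add_zero,
      Padic.valuation_mul (coe_units_ne_zero p u') hsQ0, valuation_coe_units_eq_zero, zero_add,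
      hShp_def, Padic.valuation_natCast, Padic.valuation_ratCast] at hv
    exact hv.symm
  exact ⟨fE, h, s, hchar', hgh.symm, hh0, hs, hs0, hval⟩

/-- **The Euler-system HALF on the non-split half, modulo Schneider** (datum level): under the
hypotheses of `exists_cofactor_of_nonsplit_of_schneider_datum` — ANY divisibility `g ∈ char_Λ X`,
`ι g = ϖ·L` — the typed UPPER bound `ord_p #Ш(E) ≤ ord_p #Ш(E)_an` (`Typed.MissingUpperBoundAt W p`)
holds, since `ord_p h(0) ≥ 0`. [cite: SteinWuthrich2013, Thm. 6.1 (p. 20)]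
[cite: Disegni2020, Thm. 1 and Thm. 4] [cite: Miller2011LMS, Def. 1.1] -/
theorem missingUpperBoundAt_of_nonsplit_of_mem_charIdeal_of_schneider_datum
    (hJ : thm61_nonsplitMultiplicative) (hD : thm1_padicBSD_nonsplitMultiplicative)
    (hGZK : rank_eq_analyticRank_of_analyticRank_le_one)
    (W : WeierstrassCurve ℚ) [W.IsElliptic] [W.IsGloballyMinimal] (p : ℕ) [Fact p.Prime]
    {κ : ZpExtension ℚ p} {γ : Field.absoluteGaloisGroup ℚ} {N : ℕ} [NeZero N]
    {f : CuspForm (Gamma0 N) 2} (hp2 : p ≠ 2) (hr : W.analyticRank ≤ 1)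
    (hmult : W.HasMultiplicativeReductionAtPrime p)
    (hns : ¬ W.HasSplitMultiplicativeReductionAtPrime p)
    (hκ : κ.IsCyclotomic) (hγ : κ.IsTopGenerator γ) (hγ' : IsCyclotomicVariable p γ)
    (hf : IsNewformOf W f) (D : W.SelmerDualData κ γ) (hX : D.IsTorsion) (ϖ : ℚ)
    (hϖ : (ϖ : ℝ) * W.realPeriodRat = plusPeriod f)
    (L : PowerSeries ℚ_[p]) (hL : IsMultPAdicLFunctionOf f p (-1) L)
    {q : ℚ_[p]} (hq0 : q ≠ 0) (hq1 : ‖q‖ < 1) (hqj : tateJ q = (W.j : ℚ_[p]))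
    (Dh : PAdicHeightData W p) (hDh : IsMultCanonical Dh q) (hSch : SchneiderConjecture Dh)
    (g : IwasawaAlgebra p) (hgmem : g ∈ D.charIdeal)
    (hιg : iwasawaToPowerSeries p g = PowerSeries.C ((ϖ : ℚ) : ℚ_[p]) * L) :
    Typed.MissingUpperBoundAt W p := by
  obtain ⟨-, h, s, -, -, -, hs, -, hval⟩ := exists_cofactor_of_nonsplit_of_schneider_datum hJ hD hGZK
    W p hp2 hr hmult hns hκ hγ hγ' hf D hX ϖ hϖ L hL hq0 hq1 hqj Dh hDh hSch g hgmem hιg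
  haveI : Finite W.sha := (hGZK W hr).2
  refine ⟨s, hs, ?_⟩
  have hnn : (0 : ℤ) ≤ (((PowerSeries.constantCoeff h : ℤ_[p]) : ℚ_[p])).valuation :=
    (Padic.norm_le_one_iff_val_nonneg _).mp (PadicInt.norm_le_one _)
  rw [hval, WeierstrassCurve.shaOrder, padicValNat_card_addPrimaryComponent]
  omega

/-- **X11b ∧ non-split at `p`, `ρ_{E,p^∞}` surjective (`∀ n`, as in Kato's theorem), `p ≠ 2`: the
typed UPPER half `ord_p #Ш(E) ≤ ord_p #Ш(E)_an` from PUBLISHED facts plus Schneider AT THE PAIR — NO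
(ram), NO `p ∤ ∏ c_ℓ`.** Divisibility: Kato's theorem as recorded by Wuthrich 2014 Thm. 3 / Cor. 19 =
Stein–Wuthrich Thm. 7.3 (`hK : kato_charIdeal_dvd_multiplicative_of_surjective`, `p ≠ 2`, every
reduction-compatible `ρ_{E,p^∞}` surjective); then
`missingUpperBoundAt_of_nonsplit_of_mem_charIdeal_of_schneider_datum` with the bookkeeping data
instantiated from tree theorems / published existence facts (as in
`bsdp_of_classX11b_of_nonsplit_of_ram_of_schneider`). This is the (T2′)-type Euler-system input on
the non-split half of the class, modulo Schneider's conjecture instance. CONDITIONAL; nothing booked.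
[cite: Wuthrich2014, Thm. 3 (p. 382), Cor. 19 (p. 398)] [cite: SteinWuthrich2013, Thm. 6.1 (p. 20), Thm. 7.3, §4.2]
[cite: Disegni2020, Thm. 1 and Thm. 4] [cite: Miller2011LMS, Def. 1.1] -/
theorem missingUpperBoundAt_of_classX11b_of_nonsplit_of_surjPow_of_schneider
    (hK : kato_charIdeal_dvd_multiplicative_of_surjective) (hJ : thm61_nonsplitMultiplicative)
    (hD : thm1_padicBSD_nonsplitMultiplicative) (hH : exists_isMultCanonical)
    (hLns : exists_isMultPAdicLFunctionOf_neg_one)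
    (hGZK : rank_eq_analyticRank_of_analyticRank_le_one)
    (hpar : nonempty_modularParametrizationData)
    (W : WeierstrassCurve ℚ) [W.IsElliptic] [W.IsGloballyMinimal] (p : ℕ) [Fact p.Prime]
    (hX : ClassX11b W p) (hns : ¬ W.HasSplitMultiplicativeReductionAtPrime p)
    (hρ : ∀ n : ℕ, W.HasSurjectiveModNGaloisRep (p ^ n : ℕ))
    (hSch : ∀ q : ℚ_[p], q ≠ 0 → ‖q‖ < 1 → tateJ q = (W.j : ℚ_[p]) →
      ∀ Dh : PAdicHeightData W p, IsMultCanonical Dh q → SchneiderConjecture Dh) :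
    Typed.MissingUpperBoundAt W p := by
  obtain ⟨hran, hp2, hmult, -⟩ := hX
  obtain ⟨κ, hκ, γ, hγ, hγ'⟩ := exists_isCyclotomic_isTopGenerator_isCyclotomicVariable_holds p
  obtain ⟨D⟩ := W.nonempty_selmerDualData_holds κ γ hγ
  haveI : NeZero (W.conductorNorm ℤ) := ⟨(W.conductorNorm_pos_holds).ne'⟩
  obtain ⟨Dm⟩ := hpar W
  obtain ⟨ϖ, -, hϖ, -⟩ := Dm.exists_rat_mul_realPeriodRat_eq_plusPeriod
  obtain ⟨L, hL⟩ := hLns W p Dm.f hmult hns Dm.isNewformOf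
  obtain ⟨q, ⟨hq0, hq1, hqj⟩, -⟩ := existsUnique_tateJ_eq_of_one_lt_norm
    (one_lt_norm_j_of_hasMultiplicativeReductionAtPrime (W := W) (p := p) hmult)
  obtain ⟨Dh, hDh⟩ := hH W p hp2 hmult hns q hq0 hq1 hqj
  obtain ⟨hXt, hnsp, -⟩ := hK W p hp2 hmult hρ hκ hγ hγ' Dm.isNewformOf D ϖ hϖ
  obtain ⟨g, hgmem, hιg⟩ := hnsp hns L hL
  exact missingUpperBoundAt_of_nonsplit_of_mem_charIdeal_of_schneider_datum hJ hD hGZK W p hp2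
    (le_of_eq hran) hmult hns hκ hγ hγ' Dm.isNewformOf D hXt ϖ hϖ L hL hq0 hq1 hqj Dh hDh
    (hSch q hq0 hq1 hqj Dh hDh) g hgmem hιg

/-- **The `p = 3` row of the Euler-system half: X11 ∧ `r = 1` ∧ `p = 3` (`IsX11Three W`), NON-SPLIT
at `3`, `ρ̄_{E,3}` surjective (the census bit `Surj W 3`; `3`-adic surjectivity then follows at a
multiplicative prime `3` from Wuthrich 2014 Lemma 20, `h20`, via `Typed.surjective_pow_three_of_mult`):
`ord_3 #Ш(E) ≤ ord_3 #Ш(E)_an` ⇐ PUBLISHED facts + Schneider at the pair.** NO (ram), NO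
`3 ∤ ∏ c_ℓ`: on this sub-population the (T2′)@3 binder of `P2.bsdp_three_of_onTree` is discharged
modulo Schneider's conjecture instance. CONDITIONAL; nothing booked.
[cite: Wuthrich2014, Thm. 3 (p. 382), Lemma 20 (p. 400)] [cite: SteinWuthrich2013, Thm. 6.1 (p. 20)]
[cite: Disegni2020, Thm. 1 and Thm. 4] [cite: Miller2011LMS, Def. 1.1] -/
theorem missingUpperBoundAt_three_of_isX11Three_of_nonsplit_of_surj_of_schneider
    [Fact (Nat.Prime 3)] (hK : kato_charIdeal_dvd_multiplicative_of_surjective)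
    (h20 : lemma20_surjective_threeAdic_of_semistable) (hJ : thm61_nonsplitMultiplicative)
    (hD : thm1_padicBSD_nonsplitMultiplicative) (hH : exists_isMultCanonical)
    (hLns : exists_isMultPAdicLFunctionOf_neg_one)
    (hGZK : rank_eq_analyticRank_of_analyticRank_le_one)
    (hpar : nonempty_modularParametrizationData)
    (W : WeierstrassCurve ℚ) [W.IsElliptic] [W.IsGloballyMinimal] (hX : IsX11Three W)
    (hns : ¬ W.HasSplitMultiplicativeReductionAtPrime 3) (hρ : Surj W 3)
    (hSch : ∀ q : ℚ_[3], q ≠ 0 → ‖q‖ < 1 → tateJ q = (W.j : ℚ_[3]) →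
      ∀ Dh : PAdicHeightData W 3, IsMultCanonical Dh q → SchneiderConjecture Dh) :
    Typed.MissingUpperBoundAt W 3 :=
  missingUpperBoundAt_of_classX11b_of_nonsplit_of_surjPow_of_schneider hK hJ hD hH hLns hGZK hpar W 3
    ⟨hX.rank, by decide, hX.mult, hX.irr⟩ hns (Typed.surjective_pow_three_of_mult h20 W hX.mult hρ) hSch

/-- **Closing a non-split pair WITHOUT (ram) from the Euler-system half and a LOWER certificate**
(e.g. the X11b@3 cell 318828a1: `N = 2²·3·163²`, no second multiplicative prime, `#Ш_an = 9`, exact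
`#Sel₃ = 27`): `IsX11Three W`, non-split at `3`, `Surj W 3`, Schneider at the pair, a divisibility
certificate `3^j ∣ #Ш(E/ℚ)` (from an exact `3`-descent via `pow_dvd_shaOrder_of_card_selmerGroup`,
or Cassels–Tate) and `#Ш_an = s` with `ord_3 s ≤ j` ⇒ `BSD(E,3)`. UPPER:
`missingUpperBoundAt_three_of_isX11Three_of_nonsplit_of_surj_of_schneider`; LOWER: bookkeeping
(`ord_3 s ≤ j ≤ ord_3 #Ш`); then `Typed.bsdp_of_missingPPartAt`. Per pair (two certificates: Reg_3 ≠ 0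
and the descent count); CONDITIONAL; nothing booked. [cite: Wuthrich2014, Thm. 3 (p. 382), Lemma 20 (p. 400)]
[cite: SteinWuthrich2013, Thm. 6.1 (p. 20)] [cite: Disegni2020, Thm. 1 and Thm. 4] [cite: Miller2011LMS, Def. 1.1] -/
theorem bsdp_three_of_isX11Three_of_nonsplit_of_surj_of_schneider_of_pow_dvd
    [Fact (Nat.Prime 3)] (hK : kato_charIdeal_dvd_multiplicative_of_surjective)
    (h20 : lemma20_surjective_threeAdic_of_semistable) (hJ : thm61_nonsplitMultiplicative)
    (hD : thm1_padicBSD_nonsplitMultiplicative) (hH : exists_isMultCanonical)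
    (hLns : exists_isMultPAdicLFunctionOf_neg_one)
    (hGZK : rank_eq_analyticRank_of_analyticRank_le_one)
    (hpar : nonempty_modularParametrizationData)
    (W : WeierstrassCurve ℚ) [W.IsElliptic] [W.IsGloballyMinimal] (hX : IsX11Three W)
    (hns : ¬ W.HasSplitMultiplicativeReductionAtPrime 3) (hρ : Surj W 3)
    (hSch : ∀ q : ℚ_[3], q ≠ 0 → ‖q‖ < 1 → tateJ q = (W.j : ℚ_[3]) →
      ∀ Dh : PAdicHeightData W 3, IsMultCanonical Dh q → SchneiderConjecture Dh)
    {j : ℕ} (hdvd : 3 ^ j ∣ W.shaOrder) {s : ℚ} (hs : shaAn W = (s : ℂ))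
    (hv : padicValRat 3 s ≤ j) : BSDp W 3 := by
  have hr : W.analyticRank ≤ 1 := le_of_eq hX.rank
  have hfin : W.ShaFinite := (hGZK W hr).2
  have hU := missingUpperBoundAt_three_of_isX11Three_of_nonsplit_of_surj_of_schneider hK h20 hJ hD hH
    hLns hGZK hpar W hX hns hρ hSch
  have hn : W.shaOrder ≠ 0 := (WeierstrassCurve.shaOrder_pos W hfin).ne'
  have hle : j ≤ padicValNat 3 W.shaOrder := (padicValNat_dvd_iff_le hn).mp hdvd
  have hL : Typed.MissingLowerBoundAt W 3 := ⟨s, hs, hv.trans (by exact_mod_cast hle)⟩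
  exact Typed.bsdp_of_missingPPartAt W 3 hGZK hr (Typed.missingPPartAt_of_lower_of_upper W 3 hL hU)

end Summit.BirchSwinnertonDyer.Rank1Residual.X11b.Three

end
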